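import Summits.BirchSwinnertonDyer.Rank1Residual.X11b.KolyvaginHGZOfKodairaNeron
import Literature.NumberTheory.DiophantineGeometry.KodairaSymbolUnramifiedBaseChangeProofs
import Literature.NumberTheory.EllipticCurves.HeegnerHypothesisKroneckerProofs
import Literature.NumberTheory.EllipticCurves.BSDConductorProofs
import HarnessLib

/-!
# X11b (team N8/O2): the `hGZ` clause at `p = 3` on (KN₃) from ℚ-SIDE data
# (`3 ∤ ord_ℓ Δ_min(E/ℚ)` at the multiplicative `ℓ`, no additive place of type IV / IV* over `ℚ`)

Cell `b2b-bsdres`, team x11b3; seat x11b3-p2 GEN 34 — follow-up (ii) of `WAKE-T1.md` LEAD DEAL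
#24 (x11b3-lead GEN 23), DRAFT.  THEOREMS ONLY (no definition, no named fact, no `sorry`);
`K : Type`; nothing booked; no mark / label / count / tier moves.

`KolyvaginHloc.hGZ_of_kodairaNeron_three` (`X11b/KolyvaginHGZOfKodairaNeron`) supplies the
receptacle clause `hGZ` of Gross 1991 Prop. 6.2 (1) at `p = 3` from the `K`-side hypotheses
`3 ∤ ord_w(Δ_min(E/K))` (multiplicative `w`) and Kodaira type `∉ {IV, IV*}` (additive `w`).  Under
the HEEGNER HYPOTHESIS these are ℚ-side (Cremona-table) conditions: a bad place `w` of `E/K` lies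
over a bad prime `ℓ` of `E/ℚ`, which divides the level `N` (`E` is a quotient of `J₀(N)`: good
reduction off `N`, tree `hasGoodReductionAt_of_isNewformOf_of_not_dvd`), hence splits in `K` and is
unramified (`ℓ ∤ d_K`, tree `Literature.SatisfiesHeegnerHypothesis.not_dvd_discr`; Dedekind's
discriminant theorem, Mathlib `NumberField.not_dvd_discr_iff_isUnramifiedIn`), so Tate's algorithm
is insensitive to the base change `ℚ_ℓ → K_w` (the tree's THEOREM A233
`UnramifiedBaseChange.kodairaSymbolAt_baseChange_of_ramificationIdx_eq_one_holds`: same Kodaira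
symbol, same `ord Δ_min`).

## What is proved

* `KolyvaginHloc.kodairaSymbolAt_and_ordMinimalDiscriminant_eq_of_heegner` — at a bad place `w` of
  `E/K` (Heegner hypothesis): same Kodaira symbol and `ord Δ_min` as `E/ℚ` at `w ∩ ℚ`, which is bad.
* `KolyvaginHloc.hGZ_of_kodairaNeron_three_rat` — the `hGZ` binder body at `p = 3` (VERBATIM the
  conclusion of `hGZ_of_kodairaNeron_three`) from `SatisfiesHeegnerHypothesis N K` and the ℚ-side
  hypotheses `hmult3 : ∀ v, W.HasMultiplicativeReductionAt v → ¬ 3 ∣ W.ordMinimalDiscriminant v`,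
  `hadd3 : ∀ v, W.HasAdditiveReductionAt v → W.kodairaSymbolAt v ∉ {IV, IV*}`
  (`v : HeightOneSpectrum (𝓞 ℚ)`).
* `KolyvaginHloc.hGZ_of_kodairaNeron_rat` — the same at any odd `p` (disjunct `p ≠ 3 ∨ …`).

## References

* [GrossLMS1991] B. H. Gross, *Kolyvagin's work on modular elliptic curves*, LMS LNS 153 (1991),
  Prop. 6.2 (1), §1 (Heegner hypothesis), §3 (3.1).
* [SilvermanAEC2009] J. H. Silverman, *The Arithmetic of Elliptic Curves*, 2nd ed., Prop. VII.5.4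
  (a) (unramified base change), Thm. VII.6.1.
* [SilvermanATAEC1994] J. H. Silverman, *Advanced Topics*, IV.9.4 and Table 4.1.

presearch: plumbing over tree theorems (A233 `_holds`, Dedekind discriminant theorem); `lean search
'hGZ_of_kodairaNeron_three_rat'` → no matches (INTENT-grep).
-/

noncomputable section

open scoped Classical
open WeierstrassCurve Field NumberField IsDedekindDomain Finset
open Literature.NumberTheory.EllipticCurves Literature.NumberTheory.GaloisRepresentations
open Literature.NumberTheory.EllipticCurves.RingClassField Literature.NumberTheory.EllipticCurves.ModularForms
open Literature.NumberTheory.DiophantineGeometry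

namespace Summit.BirchSwinnertonDyer.Rank1Residual.X11b.KolyvaginHloc

-- `K : Type`: the tree's ring-class class field theory is universe `0`.
variable {K : Type} [Field K] [NumberField K] {N : ℕ} {W : WeierstrassCurve ℚ}

/-- `e(w | v) = 1` for a place `w` of `K` over a place `v` of `ℚ` whose prime does not divide
`d_K` (Dedekind's discriminant theorem, Mathlib `NumberField.not_dvd_discr_iff_isUnramifiedIn`,
with the tower law `e(w|ℤ) = e(v|ℤ) · e(w|v)`). [folklore] -/
theorem ramificationIdx_eq_one_of_not_dvd_discr (v : HeightOneSpectrum (𝓞 ℚ))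
    (w : HeightOneSpectrum (𝓞 K)) [w.asIdeal.LiesOver v.asIdeal]
    (hd : ¬ ((Rat.HeightOneSpectrum.primesEquiv v : ℕ) : ℤ) ∣ NumberField.discr K) :
    w.asIdeal.ramificationIdx (𝓞 ℚ) = 1 := by
  have hpP : (Rat.HeightOneSpectrum.primesEquiv v : ℕ).Prime := (Rat.HeightOneSpectrum.primesEquiv v).2
  have hp : Prime ((Rat.HeightOneSpectrum.primesEquiv v : ℕ) : ℤ) := Nat.prime_iff_prime_int.mp hpP
  have hunr : Algebra.IsUnramifiedIn (𝓞 K)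
      (Ideal.span {((Rat.HeightOneSpectrum.primesEquiv v : ℕ) : ℤ)}) :=
    (NumberField.not_dvd_discr_iff_isUnramifiedIn K (𝓞 K) hp).mp hd
  -- `v` lies over `(p) ⊆ ℤ`
  have hpv : ((Rat.HeightOneSpectrum.primesEquiv v : ℕ) : 𝓞 ℚ) ∈ v.asIdeal :=
    (natCast_mem_asIdeal_iff_eq_primesEquiv_symm v hpP).mpr (Equiv.symm_apply_apply _ v).symm
  haveI : v.asIdeal.LiesOver (Ideal.span {((Rat.HeightOneSpectrum.primesEquiv v : ℕ) : ℤ)}) := by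
    rw [Ideal.liesOver_iff]
    have hmax : (Ideal.span {((Rat.HeightOneSpectrum.primesEquiv v : ℕ) : ℤ)}).IsMaximal :=
      PrincipalIdealRing.isMaximal_of_irreducible hp.irreducible
    haveI : (v.asIdeal.under ℤ).IsPrime := Ideal.IsPrime.under ℤ v.asIdeal
    refine hmax.eq_of_le (Ideal.IsPrime.ne_top ‹_›) ?_
    rw [Ideal.span_le, Set.singleton_subset_iff, SetLike.mem_coe, Ideal.under_def, Ideal.mem_comap,
      map_natCast]
    exact hpv
  haveI : w.asIdeal.LiesOver (Ideal.span {((Rat.HeightOneSpectrum.primesEquiv v : ℕ) : ℤ)}) :=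
    Ideal.LiesOver.trans w.asIdeal v.asIdeal _
  have h1 : w.asIdeal.ramificationIdx ℤ = 1 :=
    (Algebra.isUnramifiedIn_iff_forall_ramificationIdx_eq_one.mp hunr) w.asIdeal ‹_›
  rw [Ideal.ramificationIdx_tower (R := ℤ) v.asIdeal w.asIdeal] at h1
  exact Nat.eq_one_of_mul_eq_one_left h1

/-- `e(w | v) = 1 ⇒ ¬ v·𝓞_K ≤ w²` (the exponent of `w` in `v·𝓞_K` is `e = 1 < 2`; Mathlib
`Ideal.IsDedekindDomain.ramificationIdx'_eq_normalizedFactors_count`) — the hypothesis currency of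
the fact A233; proof as in `AdditivePotMult.not_map_le_sq_of_ramificationIdx_eq_one` (x11b3's
sibling cell), copied to keep this file's imports inside the X11b lane. [folklore] -/
theorem not_map_le_sq_of_ramificationIdx_eq_one' {v : HeightOneSpectrum (𝓞 ℚ)}
    {w : HeightOneSpectrum (𝓞 K)} (hw : w.asIdeal.under (𝓞 ℚ) = v.asIdeal)
    (he : w.asIdeal.ramificationIdx (𝓞 ℚ) = 1) :
    ¬ v.asIdeal.map (algebraMap (𝓞 ℚ) (𝓞 K)) ≤ w.asIdeal ^ 2 := by
  classical
  intro hle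
  haveI : w.asIdeal.LiesOver v.asIdeal := ⟨hw.symm⟩
  have he' : v.asIdeal.ramificationIdx' w.asIdeal = 1 := by
    rw [Ideal.ramificationIdx'_eq_ramificationIdx v.asIdeal w.asIdeal v.ne_bot]; exact he
  have hp0 : v.asIdeal.map (algebraMap (𝓞 ℚ) (𝓞 K)) ≠ ⊥ :=
    Ideal.map_ne_bot_of_ne_bot v.ne_bot
  have hcount := Ideal.IsDedekindDomain.ramificationIdx'_eq_normalizedFactors_count hp0 w.isPrime
    w.ne_bot
  rw [he'] at hcount
  have hdvd : w.asIdeal ^ 2 ∣ v.asIdeal.map (algebraMap (𝓞 ℚ) (𝓞 K)) := Ideal.dvd_iff_le.mpr hle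
  have hirr := (Ideal.prime_of_isPrime w.ne_bot w.isPrime).irreducible
  rw [UniqueFactorizationMonoid.dvd_iff_normalizedFactors_le_normalizedFactors
    (pow_ne_zero _ w.ne_bot) hp0, UniqueFactorizationMonoid.normalizedFactors_pow,
    UniqueFactorizationMonoid.normalizedFactors_irreducible hirr, normalize_eq,
    Multiset.nsmul_singleton, ← Multiset.le_count_iff_replicate_le, ← hcount] at hdvd
  omega

/-- **Transport at a bad place under the Heegner hypothesis.**  For `E = W / ℚ` elliptic with a
modular parametrisation of level `N`, `K` quadratic with the Heegner hypothesis for `N`, and a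
place `w` of `K` of bad reduction for `E/K` over the place `v` of `ℚ`: `v` is bad for `E/ℚ`
(good reduction ascends, tree `hasGoodReductionAt_baseChange_of_hasGoodReductionAt_rat`), its prime
`ℓ` divides `N` (good reduction off the level, tree `hasGoodReductionAt_of_isNewformOf_of_not_dvd`),
so `ℓ ∤ d_K` (tree `Literature.SatisfiesHeegnerHypothesis.not_dvd_discr`) and `e(w | v) = 1`
(`ramificationIdx_eq_one_of_not_dvd_discr`); by the tree's theorem A233
(`UnramifiedBaseChange.kodairaSymbolAt_baseChange_of_ramificationIdx_eq_one_holds`, Silverman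
*AEC* VII.5.4 (a)) the Kodaira symbol and `ord Δ_min` of `E/K` at `w` are those of `E/ℚ` at `v`.
[cite: SilvermanAEC2009, Prop. VII.5.4 (a) with proof (p. 197)] -/
theorem kodairaSymbolAt_and_ordMinimalDiscriminant_eq_of_heegner [NeZero N] [W.IsElliptic]
    (hK : IsImaginaryQuadratic K) (hH : SatisfiesHeegnerHypothesis N K)
    (Dt : ModularParametrizationData W N) (w : HeightOneSpectrum (𝓞 K))
    (hw : ¬ (W.baseChange K).HasGoodReductionAt w) :
    (W.baseChange K).kodairaSymbolAt w = W.kodairaSymbolAt (w.under (𝓞 ℚ)) ∧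
      (W.baseChange K).ordMinimalDiscriminant w = W.ordMinimalDiscriminant (w.under (𝓞 ℚ)) ∧
      ¬ W.HasGoodReductionAt (w.under (𝓞 ℚ)) := by
  set v : HeightOneSpectrum (𝓞 ℚ) := w.under (𝓞 ℚ) with hvdef
  haveI hlo : w.asIdeal.LiesOver v.asIdeal := ⟨rfl⟩
  -- `v` is bad for `E/ℚ`
  have hbadv : ¬ W.HasGoodReductionAt v := fun h ↦
    hw (hasGoodReductionAt_baseChange_of_hasGoodReductionAt_rat W v w h)
  -- its prime `ℓ` divides `N`, hence `ℓ ∤ d_K`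
  have hℓP : (Rat.HeightOneSpectrum.primesEquiv v : ℕ).Prime := (Rat.HeightOneSpectrum.primesEquiv v).2
  have hℓv : ((Rat.HeightOneSpectrum.primesEquiv v : ℕ) : 𝓞 ℚ) ∈ v.asIdeal :=
    (natCast_mem_asIdeal_iff_eq_primesEquiv_symm v hℓP).mpr (Equiv.symm_apply_apply _ v).symm
  have hℓN : (Rat.HeightOneSpectrum.primesEquiv v : ℕ) ∣ N := by
    by_contra hnd
    exact hbadv (hasGoodReductionAt_of_isNewformOf_of_not_dvd W Dt.isNewformOf hℓP hnd v hℓv)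
  have hℓd : ¬ ((Rat.HeightOneSpectrum.primesEquiv v : ℕ) : ℤ) ∣ NumberField.discr K :=
    Literature.SatisfiesHeegnerHypothesis.not_dvd_discr hK.1 hH hℓP hℓN
  have he : w.asIdeal.ramificationIdx (𝓞 ℚ) = 1 := ramificationIdx_eq_one_of_not_dvd_discr v w hℓd
  -- A233 along the unramified `w | v`
  haveI : PerfectField (IsLocalRing.ResidueField (v.adicCompletionIntegers ℚ)) :=
    PerfectField.ofFinite
  haveI : Finite (IsLocalRing.ResidueField (w.adicCompletionIntegers K)) :=
    HeightOneSpectrum.finite_residueField_adicCompletionIntegers K w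
  haveI : PerfectField (IsLocalRing.ResidueField (w.adicCompletionIntegers K)) :=
    PerfectField.ofFinite
  have hc : (algebraMap ℚ K).comp (algebraMap (𝓞 ℚ) ℚ) =
      (algebraMap (𝓞 K) K).comp (algebraMap (𝓞 ℚ) (𝓞 K)) := by
    rw [← IsScalarTower.algebraMap_eq, ← IsScalarTower.algebraMap_eq]
  have hwv : w.asIdeal.under (𝓞 ℚ) = v.asIdeal := rfl
  have hA := UnramifiedBaseChange.kodairaSymbolAt_baseChange_of_ramificationIdx_eq_one_holds K v w W
    hc hwv
    (not_map_le_sq_of_ramificationIdx_eq_one' hwv he)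
  exact ⟨hA.1, hA.2, hbadv⟩

/-- **The `hGZ` clause at `p = 3` on (KN₃) from ℚ-SIDE data.**  For `E = W / ℚ` elliptic with
modular parametrisation `Dt` of level `N`, `K` imaginary quadratic satisfying the Heegner
hypothesis for `N`, any level data (`M`, square-free `n` of Kolyvagin primes, ANY family `d` of
Kolyvagin–Heegner data), and the ℚ-side (Cremona-table) conditions
`3 ∤ ord_v(Δ_min(E/ℚ))` at every multiplicative place `v` of `ℚ` and Kodaira type of `E/ℚ`
`∉ {IV, IV*}` at every additive place: the receptacle clause `hGZ` of Gross 1991 Prop. 6.2 (1) at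
`p = 3` — VERBATIM the conclusion of `hGZ_of_kodairaNeron_three`, whose `K`-side hypotheses are
transported from `ℚ` place by place (`kodairaSymbolAt_and_ordMinimalDiscriminant_eq_of_heegner`:
bad places of `E/K` lie over primes `ℓ ∣ N`, split hence unramified in `K`; reduction types are
read off the Kodaira symbol, tree `isAdditive_kodairaSymbolAt_iff_holds`).  HONEST: [GZ86 III
(3.1)] is NOT proved; off (KN₃) it stays cite-only; nothing booked; no mark.
[cite: GrossLMS1991, Prop. 6.2 (1) and its proof] [cite: SilvermanAEC2009, Prop. VII.5.4 (a), Thm. VII.6.1] -/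
theorem hGZ_of_kodairaNeron_three_rat [NeZero N] [W.IsElliptic]
    (hK : IsImaginaryQuadratic K) (hH : SatisfiesHeegnerHypothesis N K) (ι : K →+* ℂ)
    (Dt : ModularParametrizationData W N) {β : ℤ} {M : ℕ} {n : ℕ} (hn : Squarefree n)
    (hKol : ∀ q ∈ n.primeFactors, IsKolyvaginPrime N W K 3 q ∧ FrobEqFrobInfty W K (3 ^ M) q)
    (d : (m : ℕ) → m ∣ n → KolyvaginHeegnerData Dt β ι m)
    (hmult3 : ∀ v : HeightOneSpectrum (𝓞 ℚ), W.HasMultiplicativeReductionAt v →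
      ¬ 3 ∣ W.ordMinimalDiscriminant v)
    (hadd3 : ∀ v : HeightOneSpectrum (𝓞 ℚ), W.HasAdditiveReductionAt v →
      W.kodairaSymbolAt v ≠ KodairaSymbol.IV ∧ W.kodairaSymbolAt v ≠ KodairaSymbol.IVstar) :
    ∃ n' : ℤ, IsCoprime ((3 ^ M : ℕ) : ℤ) n' ∧
      ∀ (m : ℕ) (hm : m ∣ n) (γ : ringClassField K ι m ≃ₐ[ℚ] ringClassField K ι m),
        γ ∈ ringClassGal ι m → ∀ v : HeightOneSpectrum (𝓞 K),
          ¬ (W.baseChange K).HasGoodReductionAt v →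
          n' • pointsMap (W.baseChange K) (v.adicCompletion K)
              ((d m hm).toGeomPoints (pointGalHom W (ringClassField K ι m) γ (d m hm).y)) ∈
            E0Receptacle (W.baseChange K) v ∧
          ∀ (ℓ : ℕ) (hℓ : ℓ ∈ m.primeFactors)
            (hle : ringClassField K ι (m / ℓ) ≤ ringClassField K ι m),
            n' • pointsMap (W.baseChange K) (v.adicCompletion K)
                ((d m hm).toGeomPoints (pointGalHom W (ringClassField K ι m) γ
                  (WeierstrassCurve.Affine.Point.map (W' := W)
                    ((RingClassField.inclusion ι hle).restrictScalars ℚ)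
                    (d (m / ℓ) ((Nat.div_dvd_of_dvd (Nat.dvd_of_mem_primeFactors hℓ)).trans hm)).y))) ∈
              E0Receptacle (W.baseChange K) v := by
  haveI : (W.baseChange K).IsElliptic := inferInstanceAs (W.map (algebraMap ℚ K)).IsElliptic
  refine hGZ_of_kodairaNeron_three hK ι Dt hn hKol d (fun w hmw ↦ ?_) (fun w haw ↦ ?_)
  · -- multiplicative `w`: `v = w ∩ ℚ` is multiplicative for `E/ℚ` and `ord_w = ord_v`
    obtain ⟨hks, hord, hbadv⟩ :=
      kodairaSymbolAt_and_ordMinimalDiscriminant_eq_of_heegner hK hH Dt w hmw.not_hasGoodReductionAt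
    rw [hord]
    refine hmult3 _ ?_
    rcases (W.localMinimalModel (w.under (𝓞 ℚ))).hasGoodReduction_or_hasMultiplicativeReduction_or_hasAdditiveReduction
        (R := (w.under (𝓞 ℚ)).adicCompletionIntegers ℚ) with hg | hm | ha
    · exact absurd hg hbadv
    · exact hm
    · exfalso
      have hKs : ((W.baseChange K).kodairaSymbolAt w).IsAdditive := by
        rw [hks]; exact (WeierstrassCurve.isAdditive_kodairaSymbolAt_iff_holds _ W).mpr ha
      exact ((WeierstrassCurve.isAdditive_kodairaSymbolAt_iff_holds w (W.baseChange K)).mp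
        hKs).not_hasMultiplicativeReductionAt hmw
  · -- additive `w`: `v` is additive for `E/ℚ` with the same Kodaira symbol
    obtain ⟨hks, -, -⟩ :=
      kodairaSymbolAt_and_ordMinimalDiscriminant_eq_of_heegner hK hH Dt w haw.not_hasGoodReductionAt
    have hav : W.HasAdditiveReductionAt (w.under (𝓞 ℚ)) := by
      have hKs : ((W.baseChange K).kodairaSymbolAt w).IsAdditive :=
        (WeierstrassCurve.isAdditive_kodairaSymbolAt_iff_holds w (W.baseChange K)).mpr haw
      rw [hks] at hKs
      exact (WeierstrassCurve.isAdditive_kodairaSymbolAt_iff_holds _ W).mp hKs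
    rw [hks]
    exact hadd3 _ hav

/-- **The `hGZ` clause at any odd prime `p` on (KN) from ℚ-SIDE data** — `hGZ_of_kodairaNeron`
(generic `p`, `p ≠ 2`, disjunct `p ≠ 3 ∨ type ∉ {IV, IV*}` at the additive places) with its
`K`-side hypotheses transported from `ℚ` under the Heegner hypothesis
(`kodairaSymbolAt_and_ordMinimalDiscriminant_eq_of_heegner`): `p ∤ ord_v(Δ_min(E/ℚ))` at every
multiplicative place `v` of `ℚ`, and `p ≠ 3 ∨` Kodaira type of `E/ℚ` at `v` `∉ {IV, IV*}` at every
additive `v`.  Conclusion VERBATIM that of `hGZ_of_kodairaNeron`.  HONEST: [GZ86 III (3.1)] is NOT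
proved; off (KN) it stays cite-only; nothing booked; no mark.
[cite: GrossLMS1991, Prop. 6.2 (1) and its proof] [cite: SilvermanAEC2009, Prop. VII.5.4 (a), Thm. VII.6.1] -/
theorem hGZ_of_kodairaNeron_rat [NeZero N] [W.IsElliptic]
    (hK : IsImaginaryQuadratic K) (hH : SatisfiesHeegnerHypothesis N K) (ι : K →+* ℂ)
    (Dt : ModularParametrizationData W N) {β : ℤ} {p M : ℕ} (hp : p.Prime) (hp2 : p ≠ 2) {n : ℕ}
    (hn : Squarefree n)
    (hKol : ∀ q ∈ n.primeFactors, IsKolyvaginPrime N W K p q ∧ FrobEqFrobInfty W K (p ^ M) q)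
    (d : (m : ℕ) → m ∣ n → KolyvaginHeegnerData Dt β ι m)
    (hmult : ∀ v : HeightOneSpectrum (𝓞 ℚ), W.HasMultiplicativeReductionAt v →
      ¬ p ∣ W.ordMinimalDiscriminant v)
    (hadd : ∀ v : HeightOneSpectrum (𝓞 ℚ), W.HasAdditiveReductionAt v → p ≠ 3 ∨
      (W.kodairaSymbolAt v ≠ KodairaSymbol.IV ∧ W.kodairaSymbolAt v ≠ KodairaSymbol.IVstar)) :
    ∃ n' : ℤ, IsCoprime ((p ^ M : ℕ) : ℤ) n' ∧
      ∀ (m : ℕ) (hm : m ∣ n) (γ : ringClassField K ι m ≃ₐ[ℚ] ringClassField K ι m),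
        γ ∈ ringClassGal ι m → ∀ v : HeightOneSpectrum (𝓞 K),
          ¬ (W.baseChange K).HasGoodReductionAt v →
          n' • pointsMap (W.baseChange K) (v.adicCompletion K)
              ((d m hm).toGeomPoints (pointGalHom W (ringClassField K ι m) γ (d m hm).y)) ∈
            E0Receptacle (W.baseChange K) v ∧
          ∀ (ℓ : ℕ) (hℓ : ℓ ∈ m.primeFactors)
            (hle : ringClassField K ι (m / ℓ) ≤ ringClassField K ι m),
            n' • pointsMap (W.baseChange K) (v.adicCompletion K)
                ((d m hm).toGeomPoints (pointGalHom W (ringClassField K ι m) γ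
                  (WeierstrassCurve.Affine.Point.map (W' := W)
                    ((RingClassField.inclusion ι hle).restrictScalars ℚ)
                    (d (m / ℓ) ((Nat.div_dvd_of_dvd (Nat.dvd_of_mem_primeFactors hℓ)).trans hm)).y))) ∈
              E0Receptacle (W.baseChange K) v := by
  haveI : (W.baseChange K).IsElliptic := inferInstanceAs (W.map (algebraMap ℚ K)).IsElliptic
  refine hGZ_of_kodairaNeron hK ι Dt hp hp2 hn hKol d (fun w hmw ↦ ?_) (fun w haw ↦ ?_)
  · obtain ⟨hks, hord, hbadv⟩ :=
      kodairaSymbolAt_and_ordMinimalDiscriminant_eq_of_heegner hK hH Dt w hmw.not_hasGoodReductionAt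
    rw [hord]
    refine hmult _ ?_
    rcases (W.localMinimalModel (w.under (𝓞 ℚ))).hasGoodReduction_or_hasMultiplicativeReduction_or_hasAdditiveReduction
        (R := (w.under (𝓞 ℚ)).adicCompletionIntegers ℚ) with hg | hm | ha
    · exact absurd hg hbadv
    · exact hm
    · exfalso
      have hKs : ((W.baseChange K).kodairaSymbolAt w).IsAdditive := by
        rw [hks]; exact (WeierstrassCurve.isAdditive_kodairaSymbolAt_iff_holds _ W).mpr ha
      exact ((WeierstrassCurve.isAdditive_kodairaSymbolAt_iff_holds w (W.baseChange K)).mp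
        hKs).not_hasMultiplicativeReductionAt hmw
  · obtain ⟨hks, -, -⟩ :=
      kodairaSymbolAt_and_ordMinimalDiscriminant_eq_of_heegner hK hH Dt w haw.not_hasGoodReductionAt
    have hav : W.HasAdditiveReductionAt (w.under (𝓞 ℚ)) := by
      have hKs : ((W.baseChange K).kodairaSymbolAt w).IsAdditive :=
        (WeierstrassCurve.isAdditive_kodairaSymbolAt_iff_holds w (W.baseChange K)).mpr haw
      rw [hks] at hKs
      exact (WeierstrassCurve.isAdditive_kodairaSymbolAt_iff_holds _ W).mp hKs
    rw [hks]
    exact hadd _ hav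

end Summit.BirchSwinnertonDyer.Rank1Residual.X11b.KolyvaginHloc

end
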